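import Mathlib.Tactic

/-!
# Feeder contents of a mixed diagonal cell: the exact decomposition behind THEOREM (Λ-EQ″)
(pub-hsemireg, W2 seat w2-t1-1, gen 25, memo `widen/W2/w2t11/lpf/g25/LAMBDA-w2t11g25.md` v1.4 §4c–§4d)

LINEAGE SIDE (not formalised): for a primitive class `τ = (t₀, t₁)` over `ℤ[ω]`, unimodular complement
`σ = (s₀, s₁)`, pencil `j` and integer `w`, wsym's Cramer numerators are `Snum_a = w (2 + D) + C_a`,
`Snum_b = w (D − 1) + C_b` with `t₀ D = −(s₀ Δ + t₁)`, `Δ = t₀² − t₀ t₁ + t₁² = δ₁ δ₂`, `δ₁ = t₀ + ω t₁`,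
`δ₂ = t₀ + ω² t₁`, `C_a = t₁ t̄₀ − N(t₀) − N(t₁)`, `C_b = −C̄_a`; `P = N(δ₁)`, `Q = N(δ₂)`, `A = P + Q`;
`X = ω (Q − 3w) − P`, `Y = ω² (P − 3w) − Q`, `λ = 1 − ω`.  §4d (i) asserts
`Snum_a = X/λ + R₁ w = −ω Y/λ + R₂ w`, `Snum_b = ω X̄/λ + R₁ w = −Ȳ/λ + R₂ w` with `δ₁ ∣ R₁ := 2 + D − λ`,
`δ₂ ∣ R₂ := 2 + D − (1 − ω²)`, whence the local law (ii) and, at `λ`, equality of the two contents.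
WHAT IS CHECKED HERE — every ring identity used in (i), over an arbitrary commutative ring with an element
`ω` satisfying `ω² + ω + 1 = 0` (conjugates appear as independent variables `u₀ = t̄₀`, `u₁ = t̄₁`, and
`X̄ = ω² (Q − 3w) − P`, `Ȳ = ω (P − 3w) − Q` since `P, Q, w` are rational):
* `lam_sq` (`λ² = −3ω`; `ω³ = 1` itself is the landed `Literature…PadicEisenstein.omega_pow_three`, not restated), `one_sub_omega_sq` (`1 − ω² = −ω² λ`), `lam_mul_lam_bar` (`λ (1 − ω²) = 3`);
* `Delta_factor` (`δ₁ δ₂ = t₀² − t₀t₁ + t₁²`), `delta_sub`, `delta_twist_sub` (so `gcd(δ₁, δ₂) ∣ λ`·unit·`gcd(t₀,t₁)`);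
* `norm_sum` (`P + Q = 2 N(t₀) + 2 N(t₁) − tr(t₀ t̄₁)` = the class invariant `A`),
  `lam_mul_Ca` (`λ C_a = ω Q − P`), `lam_mul_Cb` (`λ C_b = Q − ω P`), `Cb_eq_neg_conj_Ca` (consistency of `C_b = −C̄_a`);
* `D_congr_delta1`, `D_congr_delta2`: from `t₀ D = −(s₀ δ₁ δ₂ + t₁)`, `t₀ (D − ω²) = −δ₁ (s₀ δ₂ + ω²)` and
  `t₀ (D − ω) = −δ₂ (s₀ δ₁ + ω)` (with `gcd(t₀, δᵢ) = 1` lineage-side this is `δ₁ ∣ R₁`, `δ₂ ∣ R₂`);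
* `decomp_a_X`, `decomp_a_Y`, `decomp_b_X`, `decomp_b_Y`: the four numerator identities
  `λ² w + (ωQ − P) = X`, `λ(1 − ω²) w + (ωQ − P) = −ω Y`, `λ(λ − 3) w + (Q − ωP) = ω X̄`, `λ((1 − ω²) − 3) w + (Q − ωP) = −Ȳ`;
* `conjX_sub`, `conjY_sub` (`ω X̄ − X = λ (P + Q − 3w)`, `Ȳ − ω Y = −λ (P + Q − 3w)`) and `sdiff_of_decomp`
  (`λ (Snum_b − Snum_a) = λ (A − 3w)`: THEOREM (S-DIFF) recovered from the pieces).
RECORD ONLY; identities of the lineage's own formulas; W2 counts 0 ∕ 0 ∕ 0; LP-F-OPEN rows NAMED, NOT DECIDED;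
nothing here says HC / HC_CM / HC_AV is proved.
-/

namespace Summit.Ventures.HSemireg.FeederContentDecomposition

variable {R : Type*} [CommRing R]

section units

variable (ω : R) (hω : ω ^ 2 + ω + 1 = 0)
include hω

/-- `λ² = −3ω` for `λ = 1 − ω`. -/
theorem lam_sq : (1 - ω) ^ 2 = -3 * ω := by
  linear_combination hω

/-- `1 − ω² = −ω² λ` (the conjugate of `λ` is a unit multiple of `λ`). -/
theorem one_sub_omega_sq : 1 - ω ^ 2 = -ω ^ 2 * (1 - ω) := by
  linear_combination (1 - ω) * hω

/-- `λ λ̄ = 3`. -/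
theorem lam_mul_lam_bar : (1 - ω) * (1 - ω ^ 2) = 3 := by
  linear_combination (ω - 2) * hω

end units

section classdata

variable (ω : R) (hω : ω ^ 2 + ω + 1 = 0)
include hω

/-- `Δ = t₀² − t₀ t₁ + t₁² = (t₀ + ω t₁)(t₀ + ω² t₁)`. -/
theorem Delta_factor (t₀ t₁ : R) :
    (t₀ + ω * t₁) * (t₀ + ω ^ 2 * t₁) = t₀ ^ 2 - t₀ * t₁ + t₁ ^ 2 := by
  linear_combination (t₀ * t₁ + (ω - 1) * t₁ ^ 2) * hω

omit hω in
/-- `δ₁ − δ₂ = ω λ t₁`. -/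
theorem delta_sub (t₀ t₁ : R) : (t₀ + ω * t₁) - (t₀ + ω ^ 2 * t₁) = ω * (1 - ω) * t₁ := by
  ring

omit hω in
/-- `ω² δ₁ − ω δ₂ = −ω λ t₀`. -/
theorem delta_twist_sub (t₀ t₁ : R) :
    ω ^ 2 * (t₀ + ω * t₁) - ω * (t₀ + ω ^ 2 * t₁) = -(ω * (1 - ω)) * t₀ := by
  ring

/-- `P + Q = 2 N(t₀) + 2 N(t₁) − tr(t₀ t̄₁)` (`= A`), with `u₀ = t̄₀`, `u₁ = t̄₁`,
`P = δ₁ δ̄₁ = (t₀ + ω t₁)(u₀ + ω² u₁)`, `Q = δ₂ δ̄₂ = (t₀ + ω² t₁)(u₀ + ω u₁)`. -/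
theorem norm_sum (t₀ t₁ u₀ u₁ : R) :
    (t₀ + ω * t₁) * (u₀ + ω ^ 2 * u₁) + (t₀ + ω ^ 2 * t₁) * (u₀ + ω * u₁)
      = 2 * (t₀ * u₀) + 2 * (t₁ * u₁) - (t₀ * u₁ + t₁ * u₀) := by
  linear_combination (t₀ * u₁ + t₁ * u₀ + 2 * (ω - 1) * (t₁ * u₁)) * hω

/-- `λ C_a = ω Q − P` with `C_a = t₁ t̄₀ − N(t₀) − N(t₁)`. -/
theorem lam_mul_Ca (t₀ t₁ u₀ u₁ : R) :
    (1 - ω) * (t₁ * u₀ - t₀ * u₀ - t₁ * u₁)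
      = ω * ((t₀ + ω ^ 2 * t₁) * (u₀ + ω * u₁)) - (t₀ + ω * t₁) * (u₀ + ω ^ 2 * u₁) := by
  linear_combination ((ω - 1) * (-(t₁ * u₀) + (1 - ω) * (t₁ * u₁))) * hω

/-- `λ C_b = Q − ω P` with `C_b = −C̄_a = −(u₁ t₀ − N(t₀) − N(t₁))`. -/
theorem lam_mul_Cb (t₀ t₁ u₀ u₁ : R) :
    (1 - ω) * (t₀ * u₀ - t₀ * u₁ + t₁ * u₁)
      = (t₀ + ω ^ 2 * t₁) * (u₀ + ω * u₁) - ω * ((t₀ + ω * t₁) * (u₀ + ω ^ 2 * u₁)) := by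
  linear_combination ((ω - 1) * (t₀ * u₁ - (1 - ω) * (t₁ * u₁))) * hω

/-- Consistency of `C_b = −C̄_a`: `(Q − ωP)(1 − ω²) = −λ (ω² Q − P)` for central `P, Q`. -/
theorem Cb_eq_neg_conj_Ca (P Q : R) :
    (Q - ω * P) * (1 - ω ^ 2) = -((1 - ω) * (ω ^ 2 * Q - P)) := by
  linear_combination ((ω - 1) * (P - Q)) * hω

/-- `D ≡ ω² (mod δ₁)`: from `t₀ D = −(s₀ δ₁ δ₂ + t₁)`, `t₀ (D − ω²) = −δ₁ (s₀ δ₂ + ω²)`. -/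
theorem D_congr_delta1 (t₀ t₁ s₀ D : R)
    (hD : t₀ * D = -(s₀ * ((t₀ + ω * t₁) * (t₀ + ω ^ 2 * t₁)) + t₁)) :
    t₀ * (D - ω ^ 2) = -((t₀ + ω * t₁) * (s₀ * (t₀ + ω ^ 2 * t₁) + ω ^ 2)) := by
  linear_combination hD + ((ω - 1) * t₁) * hω

/-- `D ≡ ω (mod δ₂)`: `t₀ (D − ω) = −δ₂ (s₀ δ₁ + ω)`. -/
theorem D_congr_delta2 (t₀ t₁ s₀ D : R)
    (hD : t₀ * D = -(s₀ * ((t₀ + ω * t₁) * (t₀ + ω ^ 2 * t₁)) + t₁)) :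
    t₀ * (D - ω) = -((t₀ + ω ^ 2 * t₁) * (s₀ * (t₀ + ω * t₁) + ω)) := by
  linear_combination hD + ((ω - 1) * t₁) * hω

end classdata

section decomposition

variable (ω : R) (hω : ω ^ 2 + ω + 1 = 0)
include hω

/-- a-side, `δ₁`-form: `λ² w + (ω Q − P) = X`. -/
theorem decomp_a_X (P Q w : R) :
    (1 - ω) ^ 2 * w + (ω * Q - P) = ω * (Q - 3 * w) - P := by
  linear_combination w * hω

/-- a-side, `δ₂`-form: `λ (1 − ω²) w + (ω Q − P) = −ω Y`. -/
theorem decomp_a_Y (P Q w : R) :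
    (1 - ω) * (1 - ω ^ 2) * w + (ω * Q - P) = -(ω * (ω ^ 2 * (P - 3 * w) - Q)) := by
  linear_combination (w * (1 - 2 * ω) + P * (ω - 1)) * hω

/-- b-side, `δ₁`-form: `λ (λ − 3) w + (Q − ω P) = ω X̄`. -/
theorem decomp_b_X (P Q w : R) :
    (1 - ω) * ((1 - ω) - 3) * w + (Q - ω * P) = ω * (ω ^ 2 * (Q - 3 * w) - P) := by
  linear_combination (w * (3 * ω - 2) + Q * (1 - ω)) * hω

/-- b-side, `δ₂`-form: `λ ((1 − ω²) − 3) w + (Q − ω P) = −Ȳ`. -/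
theorem decomp_b_Y (P Q w : R) :
    (1 - ω) * ((1 - ω ^ 2) - 3) * w + (Q - ω * P) = -(ω * (P - 3 * w) - Q) := by
  linear_combination (w * (ω - 2)) * hω

/-- `ω X̄ − X = λ (P + Q − 3w)`. -/
theorem conjX_sub (P Q w : R) :
    ω * (ω ^ 2 * (Q - 3 * w) - P) - (ω * (Q - 3 * w) - P) = (1 - ω) * (P + Q - 3 * w) := by
  linear_combination ((ω - 1) * (Q - 3 * w)) * hω

/-- `Ȳ − ω Y = −λ (P + Q − 3w)`. -/
theorem conjY_sub (P Q w : R) :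
    (ω * (P - 3 * w) - Q) - ω * (ω ^ 2 * (P - 3 * w) - Q) = -((1 - ω) * (P + Q - 3 * w)) := by
  linear_combination ((1 - ω) * (P - 3 * w)) * hω

omit hω in
/-- THEOREM (S-DIFF) from the pieces: if `λ Snum_a = λ² w + λ R₁ w + (ωQ − P)` and
`λ Snum_b = (λ² − 3λ) w + λ R₁ w + (Q − ωP)` then `λ (Snum_b − Snum_a) = λ (P + Q − 3w)`. -/
theorem sdiff_of_decomp (P Q w R₁ Sa Sb : R)
    (hSa : (1 - ω) * Sa = (1 - ω) ^ 2 * w + (1 - ω) * R₁ * w + (ω * Q - P))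
    (hSb : (1 - ω) * Sb = ((1 - ω) ^ 2 - 3 * (1 - ω)) * w + (1 - ω) * R₁ * w + (Q - ω * P)) :
    (1 - ω) * (Sb - Sa) = (1 - ω) * (P + Q - 3 * w) := by
  linear_combination hSb - hSa

end decomposition

end Summit.Ventures.HSemireg.FeederContentDecomposition
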